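import Mathlib
import HarnessLib
import HarnessLib.Audit
import Summits.AtomisticToContinuum.Statement

/-!
Route: HypersonicLadder

CLOSED (retired) 2026-08-15T13:43:18Z by operator:999:1257524 — reason: not-a-thesis: assembly does not conclude the sub-problem Statement — note: D-0027 §2.1 audit (human 2026-08-15: routes that do not decide the summit are removed): the assembly concludes `HypersonicAdiabat`, not the sub-problem statement; a NEW conforming route may be opened from the same idea (generated `closes : … → _root_.HydrodynamicLimit`).. The file is kept as the record of this route; refuted decls are indexed as negative knowledge (`ledger negatives`).

# Route HypersonicLadder — cool the data and only the clock slows — depth-graded closure at fixed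
packing, adiabats carrying Z, from cold local Gibbs data (sibling-family laboratory route)

SIBLING-FAMILY (LABORATORY) ROUTE realising idea card hypersonic-ladder-cold-clock (spine; it also
absorbs the harvest of the
retired cold-window-pressureless-rung). Declared up front, as in the sector/intermediate-thesis
precedents (PhiFourLaboratory,
SwirlSignGeometry): the local Target is NOT the conjunct and is not claimed to imply it, nor does
the conjunct imply it — the
conjunct is the β = 0 endpoint of the family below, where feedback (O(1) pressure) switches on; the
Assembly ends in the local
Target. Keep the conjunct's system VERBATIM (N+1 hard spheres of diameter σ(N+1)^(-1/3) on 𝕋³,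
deterministic flow, local Gibbs
data, convergence in probability of empirical fields) and change ONE datum: the temperature profile
is cold, θ_N = (N+1)^(-2β)·θ₀,
with u₀ = O(1). Hard cores are athermal, so the collision GEOMETRY (excluded volume, ring fraction
O(σ³) per collision, packing
ρσ³) is untouched and only the collision CLOCK slows: depth = collisions per particle per
macroscopic time ≍ N^(1/3−β). It suffices,
for the adiabatic rungs 0 < β < 1/3, to show X = HypersonicAdiabat: before the first caustic of the
pressureless (Burgers) flow
(ρ̄, ū) of the cold data and under an explicit packing guard ρ̄σ³ < η₀, (a) the empirical
density/momentum/energy fields follow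
PRESSURELESS Euler, and (b) the rescaled thermal field (N+1)^(2β)·Σᵢχ(xᵢ)|vᵢ − ū(t,xᵢ)|²/2N
converges in probability to
(3/2)∫χρ̄θ̂ where θ̂ solves the hard-sphere ADIABAT ∂ₜθ̂ + ū·∇θ̂ + (2/3)θ̂ Z(ρ̄σ³)∇·ū = 0 — the full
equation of state
Z = hsCompressibility is audible only through adiabatic heating while the flow itself is silent
(pressureless). X is reached from
three cruxes by a typed glue (modulated kinetic energy à la Han-Kwan–Iacobelli + uniqueness for
linear transport): kinetic
isotropisation at depth N^(1/3−β) (rank 2), the collisional heating law = the (Z−1) part of p dV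
work along the evolved cold law
(rank 3), and tightness of the rescaled cubic peculiar moment (rank 4, the cold form of the
tails-and-rattlers input). Two further
rungs are filed for the laboratory: the critical rung β = 1/3 (finite depth: a Lanford regime at
FIXED packing hidden in Hilbert's
scaling; rank 5, LLN form) and the collision-sparse top rung β > 1/3 (support; codeforming
anisotropic thermal cloud, no EOS).
Summit-side use: KineticIsotropisation(β) is the conjunct's closure (traceless stress → 0 in time
average; FluxClosure
stmt-AtomisticToContinuum-0823, KW of route KineticWindows, WarmAnisotropyRare of card
warm-isotropises-cold-is-priced) with the
Euler feedback replaced by an explicit smooth driver and the depth made tunable at constant ring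
geometry — the cheapest statements
on the board carrying BOTH fixed-density difficulties (rings at O(σ³), Z in the target) and NO
hydrodynamic nonlinearity; every
isotropisation engine on file is graded by the largest β it reaches.
Lean: `∃ η₀ : ℝ, 0 < η₀ ∧ ∀ β : ℝ, 0 < β → β < 1 / 3 → ∀ (a₀ θ₀ :
Literature.MathematicalPhysics.KineticTheory.T3 → ℝ) (u₀ :
Literature.MathematicalPhysics.KineticTheory.T3 → Literature.MathematicalPhysics.KineticTheory.V3),
Continuous a₀ → Continuous θ₀ → Continuous u₀ → (∀ x, 0 < a₀ x) → (∀ x, 0 < θ₀ x) → ∃ σ₀ : ℝ, 0 < σ₀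
∧ ∀ σ : ℝ, 0 < σ → σ < σ₀ → ∀ (T : ℝ) (ρ : ℝ → Literature.MathematicalPhysics.KineticTheory.T3 → ℝ)
(u : ℝ → Literature.MathematicalPhysics.KineticTheory.T3 →
Literature.MathematicalPhysics.KineticTheory.V3),
Literature.Analysis.FunctionSpaces.Torus.IsSmoothSpaceTimeOn (Set.Ico 0 T) ρ →
Literature.Analysis.FunctionSpaces.Torus.IsSmoothSpaceTimeOn (Set.Ico 0 T) u → (∀ t ∈ Set.Ico 0 T, ∀
x, 0 < ρ t x) → (∀ t ∈ Set.Ico 0 T, ∀ x, ρ t x * σ ^ 3 < η₀) → (∀ t ∈ Set.Ico 0 T, ∀ x,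
Literature.Analysis.FunctionSpaces.Torus.timeDerivWithin (Set.Ico 0 T) ρ t x +
Literature.Analysis.FunctionSpaces.Torus.divergence (fun y => ρ t y • u t y) x = 0) → (∀ t ∈ Set.Ico
0 T, ∀ x, Literature.Analysis.FunctionSpaces.Torus.timeDerivWithin (Set.Ico 0 T) u t x +
Literature.Analysis.FunctionSpaces.Torus.convect (u t) (u t) x = 0) → ∀ (θ : ℝ →
Literature.MathematicalPhysics.KineticTheory.T3 → ℝ),
Literature.Analysis.FunctionSpaces.Torus.IsSmoothSpaceTimeOn (Set.Ico 0 T) θ → (∀ t ∈ Set.Ico 0 T, ∀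
x, 0 < θ t x) → (∀ x, θ 0 x = θ₀ x) → (∀ t ∈ Set.Ico 0 T, ∀ x,
Literature.Analysis.FunctionSpaces.Torus.timeDerivWithin (Set.Ico 0 T) θ t x +
Literature.Analysis.FunctionSpaces.Torus.convect (u t) (θ t) x + 2 / 3 * θ t x *
Literature.MathematicalPhysics.KineticTheory.hsCompressibility (ρ t x * σ ^ 3) *
Literature.Analysis.FunctionSpaces.Torus.divergence (u t) x = 0) → ∀ Φ : (N : ℕ) →
Literature.Analysis.FluidPDE.HardSphereFlow (Literature.Analysis.FluidPDE.Torus.geometry (Fin 3))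
(Literature.MathematicalPhysics.KineticTheory.hsDiameter σ N) (N + 1),
Literature.MathematicalPhysics.KineticTheory.TendstoHydroFieldsAt (fun N =>
Literature.MathematicalPhysics.KineticTheory.localGibbsLaw σ a₀ u₀ (fun x => ((N + 1 : ℕ) : ℝ) ^
(-(2 * β)) * θ₀ x) N (Φ N)) Φ ρ u (fun _ _ => (0 : ℝ)) 0 → (∀ χ :
Literature.MathematicalPhysics.KineticTheory.T3 → ℝ, Continuous χ → ∀ δ > (0 : ℝ), Filter.Tendsto
(fun N : ℕ => (Literature.MathematicalPhysics.KineticTheory.localGibbsLaw σ a₀ u₀ (fun x => ((N + 1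
: ℕ) : ℝ) ^ (-(2 * β)) * θ₀ x) N (Φ N)) {z | δ < |((N + 1 : ℕ) : ℝ) ^ (2 * β) * (∫ y, χ y.1 * (‖y.2
- u 0 y.1‖ ^ 2 / 2) ∂Literature.Analysis.FluidPDE.empiricalMeasure ((Φ N).flow 0 z)) - ∫ x, χ x * (3
/ 2 * ρ 0 x * θ₀ x)|}) Filter.atTop (nhds 0)) → ∀ t ∈ Set.Ico 0 T,
Literature.MathematicalPhysics.KineticTheory.TendstoHydroFieldsAt (fun N =>
Literature.MathematicalPhysics.KineticTheory.localGibbsLaw σ a₀ u₀ (fun x => ((N + 1 : ℕ) : ℝ) ^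
(-(2 * β)) * θ₀ x) N (Φ N)) Φ ρ u (fun _ _ => (0 : ℝ)) t ∧ (∀ χ :
Literature.MathematicalPhysics.KineticTheory.T3 → ℝ, Continuous χ → ∀ δ > (0 : ℝ), Filter.Tendsto
(fun N : ℕ => (Literature.MathematicalPhysics.KineticTheory.localGibbsLaw σ a₀ u₀ (fun x => ((N + 1
: ℕ) : ℝ) ^ (-(2 * β)) * θ₀ x) N (Φ N)) {z | δ < |((N + 1 : ℕ) : ℝ) ^ (2 * β) * (∫ y, χ y.1 * (‖y.2
- u t y.1‖ ^ 2 / 2) ∂Literature.Analysis.FluidPDE.empiricalMeasure ((Φ N).flow t z)) - ∫ x, χ x * (3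
/ 2 * ρ t x * θ t x)|}) Filter.atTop (nhds 0))`

## Assembly
Pure logic given the glue item (proved in Sketch.lean: `fun h2 h3 h4 g => g h2 h3 h4`). The Assembly
ends in the LOCAL Target
HypersonicAdiabat, not in HydrodynamicLimit: no rung with β > 0 implies the conjunct (one-way
coupling, N-dependent temperature;
the limits N → ∞ and β → 0 do not commute) and an item 'HypersonicAdiabat → HydrodynamicLimit' would
be the conjunct in disguise —
deliberately NOT filed. CriticalRungLLN and HypersonicSparse are rungs of the same laboratory
outside the implication chain (the
β = 1/3 endpoint where crux 2 fails and finite-depth technology applies first; the provable-first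
top rung).

Rationale: WHY THIS LINE. Mechanism: velocity scaling is an exact symmetry of hard-sphere dynamics and p =
ρθZ(ρσ³) is linear in θ, so cooling the data
turns temperature into a pure collision-DEPTH dial at fixed geometry (reduced shear rate a* =
‖∇u‖·τ_coll ≍ N^(β−1/3): the
control parameter of sheared hard-sphere kinetic theory, Garzó–Santos 2003 zbl:1140.82030; kinetic
shadow = homoenergetic Boltzmann
flows, whose collision-dominated / self-similar / hyperbolic-dominated trichotomy
doi:10.1007/s00332-019-09535-6,
doi:10.1007/s00205-018-1289-2, doi:10.1088/1361-6544/ab853f is exactly β < 1/3 / β = 1/3 / β > 1/3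
here). Engine for the
adiabatic rungs: the modulated KINETIC energy Σ|vᵢ − ū(t,xᵢ)|²/2N relative to the KNOWN Burgers
driver — the monokinetic
mean-field engine of HanKwanIacobelli2021 / Serfaty2020 (vacuous for thermal data) is exactly right
for a cold collisional gas:
its smallness gives the pressureless bulk fields for free (glue), its (N+1)^(2β)-rescaling IS the
thermal field, and its exact
balance splits into transport + kinetic stress work + collisional work, so identification reduces to
isotropy (crux 2) and the
contact-value law (crux 3), tightness to a cubic moment (crux 4). Imported areas: non-equilibrium
kinetic theory of sheared gases
(a*-classification, homoenergetic flows), mean-field modulated-energy limits,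
short-time/finite-depth kinetic theory at positive
density (Lanford1975, King1975, GallagherSaintRaymondTexier2013, PulvirentiSimonella2016) for the
critical rung. What no prior
route has: a depth parameter — all nine routes on the sub are β = 0 architectures with feedback;
negatives index empty.

RANKED CRUXES. #0 HypersonicAdiabat (target) — ADIABATIC RUNGS (0 < β < 1/3). ∃η₀ ∀β∈(0,1/3) ∀
continuous profiles a₀, θ₀ > 0, u₀ ∃σ₀ ∀σ∈(0,σ₀) ∀T ∀ smooth (ρ̄ > 0, ū) on [0,T) solving
pressureless Euler (∂ₜρ̄ + div(ρ̄ū) = 0, ∂ₜū + (ū·∇)ū = 0) with packing guard ρ̄σ³ < η₀, ∀ smooth θ̂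
> 0 with θ̂(0) = θ₀ solving ∂ₜθ̂ + (ū·∇)θ̂ + (2/3)θ̂ Z(ρ̄σ³) div ū = 0, ∀ hard-sphere flows Φ: if
under the cold local Gibbs laws (temperature (N+1)^(-2β)θ₀) the fields at t = 0 converge to (ρ̄, ū,
temperature 0) and the rescaled thermal field to (3/2)ρ̄(0)θ₀, then for every t < T the fields
converge to the pressureless values and the rescaled thermal field to (3/2)ρ̄θ̂(t) (card rungs
(0,1/3)). (why it might fail: it contains the conjunct's closure at reduced depth (crux 2) and an
out-of-equilibrium EOS statement (crux 3); near β → 1/3 depth N^(1/3−β) grows arbitrarily slowly and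
near β → 0 pressure corrections O(N^(-2β)) decay arbitrarily slowly.) [Spohn1991,
HanKwanIacobelli2021, doi:10.1007/s00332-019-09535-6, zbl:1140.82030]
#2 KineticIsotropisation (crux) — KINETIC ISOTROPISATION AT DEPTH N^(1/3−β) (card crux 1, kinetic
half): same data/driver/guard as the Target (no θ̂ needed); for every t < T and every jointly
continuous field of test operators B(s,x) ∈ L(ℝ³): (N+1)^(2β)·∫₀ᵗ N⁻¹Σᵢ[⟨wᵢ, B(s,xᵢ)wᵢ⟩ − |wᵢ|² tr
B(s,xᵢ)/3] ds → 0 in probability, wᵢ = vᵢ − ū(s,xᵢ(s)) — the time-integrated rescaled TRACELESS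
kinetic peculiar stress vanishes. [difficulty: open-problem] (why it might fail: it IS the closure
for deterministic spheres (BoltzmannHypothesis barrier in substance) at depth N^(1/3−β) with rings
present at O(σ³); a proof must exhibit dilution of shared collision ancestry at FIXED packing; false
at β = 1/3 (JNV self-similar anisotropic states).) [Spohn1991, OllaVaradhanYau1993,
doi:10.1007/s00332-019-09535-6, doi:10.1007/s00205-018-1289-2]
#3 CollisionalHeatingLaw (crux) — COLLISIONAL HEATING LAW = the (Z−1) part of p dV work (card:
'adiabats carrying Z'; contact-value statistics along the evolved cold law), typed WITHOUT a
collision API through the exact pathwise balance of the modulated energy: for t < T and every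
space-time test function χ smooth on [0,t]×𝕋³, (N+1)^(2β)·[K_N(t,χ_t) − K_N(0,χ_0) − ∫₀ᵗ(transport
(∂ₛχ + v·∇χ)|w|²/2 − kinetic stress work χ⟨w,(w·∇)ū⟩) ds + ∫₀ᵗ N⁻¹Σᵢχ(s,xᵢ)(Z(ρ̄(s,xᵢ)σ³) − 1)|wᵢ|²
div ū(s,xᵢ)/3 ds] → 0 in probability, K_N(t,χ_t) = N⁻¹Σᵢχ(t,xᵢ)|vᵢ − ū(t,xᵢ)|²/2; the bracket equals
pathwise (collisional work on the thermal cloud) + ∫(Z−1)·(isotropic kinetic compression heating),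
so the law says: collisional heating = (Z−1) × kinetic compression heating, locally in space-time.
[difficulty: XL] (why it might fail: the pair correlation AT CONTACT along the evolved cold law must
take its local-equilibrium value (↔ Z−1) with isotropic contact normals; cold caged clusters / force
chains transmit collisional stress at vanishing kinetic energy (rattler problem (R): positive
packing bites here first).) [Spohn1991, Ruelle1969, PulvirentiSimonella2016,
GallagherSaintRaymondTexier2013]
#4 ThermalTightness (crux) — COLD TAILS-AND-RATTLERS INPUT (card crux 3, cubic form required by the
glue's transport term): same setting; for every t < T the rescaled cubic peculiar moments
(N+1)^(3β)·N⁻¹Σᵢ|vᵢ − ū(t,xᵢ)|³ and their time integrals over [0,t] are tight (bounded in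
probability uniformly in N). [difficulty: L] (why it might fail: no anomalous heating and no fat
peculiar tails along the deterministic evolution: pathwise Povzner-type control of collision
cascades at positive packing is open (apriori-tails-and-rattlers (T),(R)); a Gronwall for the
quadratic moment needs a mean collisional-pressure bound, the cubic one more.) [Spohn1991,
HanKwanIacobelli2021, KipnisLandim1999]
#5 CriticalRungLLN (crux) — CRITICAL RUNG β = 1/3 (card crux 2, law-of-large-numbers form): a
LANFORD REGIME AT FIXED PACKING hidden in Hilbert's scaling — O(1) collisions per particle per
macroscopic time (Nε²wt = O(1) for the peculiar motion although Nε³ = σ³ is fixed) in the slowly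
deforming affine frame ∇ū: there is a continuous positive field θc(t,x) (a local functional Θ_σ of
the deformation history, non-Maxwellian peculiar law — the N-body counterpart of homoenergetic
flows) such that, under the same t = 0 hypotheses, the fields follow pressureless Euler and the
rescaled thermal field converges in probability to (3/2)ρ̄θc(t) for all t < T. [difficulty:
open-problem] (why it might fail: a deterministic limit at all t < T needs finite-depth propagation
of chaos at FIXED packing along a deforming frame — classical in spirit only for c(σ)t below a
Lanford radius (finite recollision classes must be kept, bookkeeping never written at positive
packing); beyond it nothing is known.) [Lanford1975, King1975, GallagherSaintRaymondTexier2013,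
PulvirentiSimonella2016, doi:10.1007/s00205-018-1289-2, arXiv:2506.15449]
#9 HypersonicSparse (support) — COLLISION-SPARSE TOP RUNG β > 1/3 (card S1): a typical particle
never collides before the caustic (collision graph ⊂ a static random geometric graph of degree O(t
N^(1/3−β) √log N)); the fields follow pressureless Euler and the rescaled peculiar COVARIANCE field
(N+1)^(2β)·N⁻¹Σᵢχ(xᵢ)⟨wᵢ,e₁⟩⟨wᵢ,e₂⟩ converges to ∫χρ̄⟨e₁,Σe₂⟩ where the smooth operator field Σ
codeforms: ∂ₜΣ + (ū·∇)Σ + AΣ + ΣAᵀ = 0, A = ∇ū (Lagrangian form Σ = F⁻¹Θ₀F⁻ᵀ, F = I + t∇ū₀) —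
anisotropic, no equation of state, teeth of the ladder (the ideal gas passes this rung and fails
every adiabatic one). Proof plan: Gaussian max of peculiar speeds, deterministic TUBE LEMMA (true
collisions ⊂ pairs whose free-flight paths come within ε + 2w*t), degree bound of the static graph
under the canonical hard-sphere law at small packing, ELASTIC CONVEXITY bootstrap after ≤ K
collisions, static free-flight LLN. [difficulty: L] [Spohn1991, doi:10.1088/1361-6544/ab853f,
Ruelle1969, Sznitman1991]
#9 AdiabatGlue (support) — MODULATED-ENERGY GLUE: KineticIsotropisation → CollisionalHeatingLaw →
ThermalTightness → HypersonicAdiabat. Proof plan (soft, no collision API): (1) tightness ⇒ K_N(t,1)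
→ 0 ⇒ velocities concentrate on ū(t,x) (monokinetic mechanism of HanKwanIacobelli2021) ⇒ with the
exact microscopic mass balance the empirical density is asymptotically a measure solution of the
continuity equation with the smooth field ū, unique ⇒ density, momentum, energy fields →
pressureless values; (2) the rescaled thermal measures e_N(s) = (N+1)^(2β)|w|²/2·(empirical measure)
are tight; the pathwise balance of K_N + crux 2 (stress work → (2/3)e div ū) + crux 3 (collisional
work → (Z−1)(2/3)e div ū) + crux 4 (cubic transport remainder (N+1)^(2β)∫|w·∇χ||w|² = O(N^(-β)) → 0)
show every limit point solves weakly ∂ₛe + div(e ū) = −(2/3)Z(ρ̄σ³)(div ū) e with e(0) = (3/2)ρ̄₀θ₀;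
(3) uniqueness for this linear transport equation with smooth coefficients ⇒ e = (3/2)ρ̄θ̂. Take η₀,
σ₀ as minima over the three cruxes. [difficulty: L] [HanKwanIacobelli2021, Serfaty2020,
doi:10.2140/apde.2019.12.843]

TWO-LAYER PLAN. Foreseen glued splits (none filed now): KineticIsotropisation ⇐
SmallKappaIsotropisation (β ∈ (1/3 − κ₀, 1/3): depth N^κ, κ ≤ κ₀,
the branching horizon N^κ ≫ log N with rings present) → MonotoneInDepth (isotropisation propagates
down the ladder given crux 4) →
KineticIsotropisation; ThermalTightness ⇐ ColdRattlerBound (mean time-integrated collisional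
pressure ≤ C(η₀)·mean peculiar kinetic
energy, in measure; needs the shared contact/collision-flux definition) → QuadraticGronwall → cubic
upgrade; CriticalRungLLN ⇐
ShortTimeFixedPackingLanford (c(σ)t below a Lanford radius, finite recollision classes kept) →
extension. HypersonicSparse ⇐ TubeLemma
+ ElasticConvexity (deterministic, about IsHardSphereTrajectory; shared with card
collisionless-corners-log-price) → StaticGraphDegree.

KILL CRITERIA. Refutation of KineticIsotropisation at some β ∈ (0,1/3) (N-independent saturation of
the time-averaged traceless peculiar stress under
smooth cold shear data) closes the route `refuted:KineticIsotropisation` AND refutes the conjunct's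
closure in its easiest form — file
¬FluxClosure-type statements on DissipativeWeakStrong/KineticWindows then. Refutation of
CollisionalHeatingLaw with crux 2 intact ⇒
pivot: the adiabat carries an effective Z_eff ≠ Z (out-of-equilibrium contact value) — restate the
Target with Z_eff as an unknown
functional and keep the laboratory. Refutation of ThermalTightness by fat tails ⇒ restate with
truncated moments (o(1)-mass truncations
are glue-compatible). HypersonicSparse refuted ⇒ the tube/elastic-convexity picture is wrong: close
the route (the ladder's kinematics
would be broken). A proof of FluxClosure (0823) or KW at β = 0 by an engine insensitive to depth
moots cruxes 2–3 (they become corollaries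
of the method, not of the statement).

NOT DECOMPOSED YET. The rattler bound in its natural collisional-pressure form and the
contact-normal statistics (need the shared contact/collision-flux
API — definition request below); the Lanford-radius short-time version of CriticalRungLLN and its
identification of Θ_σ by a finite-depth
cluster expansion (not typable: the limit functional is unknown); uniformity of constants in β (each
rung is a separate statement; no
monotonicity in β is claimed as an item); N-dependent activity corrections to the LLN density; the
(N+1)^(2β)-order pressure correction
to the bulk momentum (a sharper rung-(a) statement, true for β < 1/4 only because of CLT
fluctuations) — all layer 2.

CHEAPEST FALSIFIER. (i) Kinematic premise 'geometry fixed, only depth varies': the ring/recollision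
fraction per collision is set by ℓ/ε = 1/(√2πρ̄σ³) —
a function of packing alone (solid angle ε²/ℓ², speed-free); a speed dependence would collapse the
ladder into alpha-ladder (checked by
hand this session: ℓ = N^(−1/3)/(√2πρ̄σ²), ε = σN^(−1/3)). (ii) Event-driven MD (kit, DynamO-class):
N = 10⁵–10⁶, φ = 0.05, Taylor–Green or
sinusoidal shear u₀, θ_N chosen so that ν_β t ∈ {1, 10, 100}: the time-averaged traceless peculiar
stress must decay ≍ (ν_β t)⁻¹ (JNV
collision-dominated asymptotics) and the measured heating must fit (2/3)θ̂Z(ρ̄σ³)∇·ū with the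
Carnahan–Starling Z; an N-independent
anisotropy plateau kills crux 2, a heating rate fitting Z = 1 kills crux 3. (iii) HypersonicSparse:
check the elastic-convexity constant
(1 + 3t‖∇ū₀‖)^K on an explicit 3-particle cascade. Not run this session (kit not in the plancard
budget); recorded for refuters.

NUMBERS. Orders (card, re-derived): peculiar speed w ≍ N^(−β); mean free path ℓ = N^(−1/3)/(√2πρσ²)
(speed-free); collision rate per particle
ν_β ≍ σ²N^(1/3−β); pressure ρθ_N Z = O(N^(−2β)); viscous stress O(N^(−β−1/3)); rescaled viscous
heating O(N^(β−1/3)) → 0 iff β < 1/3;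
rescaled heat conduction O(N^(−β−1/3)); rescaled collisional work O(σ³) = O(Z − 1) (Z = 1 +
(2π/3)ρσ³ + …, Ruelle1969); cubic transport
remainder in the glue O(N^(−β)) given crux 4; CLT floor of field fluctuations N^(−1/2).
Codeformation law of the top rung: w(t) = F⁻¹w₀,
Σ = F⁻¹Θ₀F⁻ᵀ, F = I + t∇ū₀ (checked: ∇ū₀ commutes with F). Items at open: 8 (1 target, 4 cruxes, 2
support, 1 assembly).

DEFINITION REQUESTS. (1) Contact/collision-flux functional of a hard-sphere trajectory
(time-integrated collisional momentum and energy transfer paired with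
test fields) over `Literature.Analysis.FluidPDE.IsHardSphereTrajectory` / `HardSphereFlow` — shared
request with transient-covariance-identity,
KineticWindows and warm-isotropises-cold-is-priced; needed for the layer-2 ColdRattlerBound and
contact-normal statistics (crux 3 was typed
around it via the pathwise energy balance). (2) Optional plumbing: `pressurelessFlowMap u₀ t` and
the caustic time on 𝕋³ (here avoided by
hypothesising the smooth Burgers solution, exactly as the conjunct hypothesises the Euler solution).
No new Literature facts are imported:
every statement hypothesises its t = 0 law of large numbers, as `HydrodynamicLimitFor` does, so the
unproved fact `localGibbs_lln` is not in
the cone.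

Novelty: Searches (2026-08-15; local searchd down, OpenAlex/arXiv 429, zbMATH up): zbMATH "homoenergetic
solutions Boltzmann equation" (8: JNV
doi:10.1007/s00205-018-1289-2, doi:10.1007/s00332-019-09535-6, doi:10.1088/1361-6544/ab853f,
Nota–Velázquez doi:10.3934/mine.2023019,
Bobylev–Nota–Velázquez doi:10.1007/s00220-020-03858-2); zbMATH "pressureless Euler particle system
limit" (6: Figalli–Kang
doi:10.2140/apde.2019.12.843, Carrillo–Choi doi:10.1007/s00205-021-01676-x — alignment/mean-field
only); zbMATH "Garzó Santos kinetic
theory gases shear flows" (zbl:1140.82030 confirmed); zbMATH "pressureless Euler limit cold gas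
particles monokinetic", "uniform shear flow
hard spheres reduced shear rate", "hypersonic limit kinetic theory hard spheres cold" (0 hits each);
`lit frontier AtomisticToContinuum
--since 2022` (30 rows: DHM expositions arXiv:2602.04407, Bose gas, chains — nothing
cold/hypersonic); `lit bridges AtomisticToContinuum
--cross any` (nothing relevant); the 135 cards and 9 routes of the sub (only
cold-window-pressureless-rung, retired into this card, and
homoenergetic-objective-md-rung (global affine, β = 0) touch the mechanism); plus the card's own
audited search list.
Nearest prior art found: Garzó–Santos 2003 zbl:1140.82030 (reduced shear rate a* as the sole control
parameter of sheared elastic hard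
spheres — the organising identity, kinetic level); JNV homoenergetic flows
doi:10.1007/s00332-019-09535-6 / doi:10.1007/s00205-018-1289-2 /
doi:10.1088/1361-6544/ab853f (Bol  [refs: 10.1007/s00205-018-1289-2, 10.1007/s00332-019-09535-6, 10.1088/1361-6544/ab853f, 10.3934/mine.2023019, 10.1007/s00220-020-03858-2, 10.2140/apde.2019.12.843, 10.1007/s00205-021-01676-x, 2602.04407, doi:10.1007/s00205-018-1289-2, doi:10.1007/s00332-019-09535-6, doi:10.1088/1361-6544/ab853f, doi:10.3934/mine.2023019, doi:10.1007/s00220-020-03858-2, doi:10.2140/apde.2019.12.843, doi:10.1007/s00205-021]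

Barriers (technique_class: scaling-ladder modulated-energy finite-depth-expansion): - technique_class: scaling-ladder modulated-energy finite-depth-expansion
- Literature.Barriers.AtomisticToContinuum.BoltzmannHypothesisBarrierNarrow: met IN SUBSTANCE by
KineticIsotropisation (a closure statement for deterministic spheres — the documented absence of
proof applies) and evaded IN FORM: no classification of infinite-volume stationary states, no
one-block step; a finite-time isotropisation at prescribed depth N^(1/3−β) against an explicit
smooth driver, in probability; the ideal-gas kernel is respected with teeth (free flight fails every
adiabatic rung — codeforms forever — and passes the top rung). The bet: depth-graded isotropisation
with an explicit driver is the weakest true closure statement carrying both fixed-density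
difficulties.
- Literature.Barriers.AtomisticToContinuum.BoltzmannHypothesisBarrier: same as the Narrow record
(superseded scope); no relative-entropy/GPV step is used anywhere in the route.
- Literature.Barriers.AtomisticToContinuum.DiluteRegimeBarrierNarrow: NOT met, deliberately —
(N+1)ε³ = σ³ on every rung and Z(ρ̄σ³) sits in the Target; the Boltzmann–Grad-like relation Nε²wt =
O(1) at β = 1/3 concerns the PECULIAR motion at fixed excluded volume, not a diameter rescaling, so
the vanishing-volume-fraction kernel does not apply; no Boltzmann equation is an intermediate.
- Literature.Barriers.AtomisticToContinuum.DiluteRegimeBarrier: as above (parent record).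
- Literature.Barriers.AtomisticToContinuum.NoDensityExpansionBarrierNarrow: clause

History (route lifecycle, newest last):
- 2026-08-15T13:43:18Z · CLOSED retired — not-a-thesis: assembly does not conclude the sub-problem Statement (operator:999:1257524)

sub-problem: HydrodynamicLimit · status: closed(retired) · opened planner-plancard-AtomisticToContinuum-Hydrody-0c719ee9-0 2026-08-15T11:46:05Z · rev 0 · ledger route-AtomisticToContinuum-HypersonicLadder
GENERATED by the gate from the ledger (D-0016/17). Provers cite these decls: `theorem foo : Summit.AtomisticToContinuum.HydrodynamicLimit.Theses.HypersonicLadder.<Decl> := …` in Summits/AtomisticToContinuum/HydrodynamicLimit/Theorems/<Name>.lean.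
-/

namespace Summit.AtomisticToContinuum.HydrodynamicLimit.Theses.HypersonicLadder

open scoped BigOperators Topology Manifold Classical MeasureTheory ProbabilityTheory Matrix InnerProductSpace ComplexConjugate ContinuousMap
open Filter Set Function TopologicalSpace MeasureTheory

attribute [summit_statement] _root_.HydrodynamicLimit

/-- item stmt-AtomisticToContinuum-6341 · target · rank 0 · closed · moot by None · by planner
why it might fail: it contains the conjunct's closure at reduced depth (crux 2) and an out-of-equilibrium EOS statement (crux 3); near β → 1/3 depth N^(1/3−β) grows arbitrarily slowly and near β → 0 pressure corrections O(N^(-2β)) decay arbitrarily slowly.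
sources: Spohn1991, HanKwanIacobelli2021, doi:10.1007/s00332-019-09535-6, zbl:1140.82030
[target] ADIABATIC RUNGS (0 < β < 1/3). ∃η₀ ∀β∈(0,1/3) ∀ continuous profiles a₀, θ₀ > 0, u₀ ∃σ₀
∀σ∈(0,σ₀) ∀T ∀ smooth (ρ̄ > 0, ū) on [0,T) solving pressureless Euler (∂ₜρ̄ + div(ρ̄ū) = 0, ∂ₜū +
(ū·∇)ū = 0) with packing guard ρ̄σ³ < η₀, ∀ smooth θ̂ > 0 with θ̂(0) = θ₀ solving ∂ₜθ̂ + (ū·∇)θ̂ +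
(2/3)θ̂ Z(ρ̄σ³) div ū = 0, ∀ hard-sphere flows Φ: if under the cold local Gibbs laws (temperature
(N+1)^(-2β)θ₀) the fields at t = 0 converge to (ρ̄, ū, temperature 0) and the rescaled thermal field
to (3/2)ρ̄(0)θ₀, then for every t < T the fields converge to the pressureless values and the
rescaled thermal field to (3/2)ρ̄θ̂(t) (card rungs (0,1/3)). -/
@[route_item "route-AtomisticToContinuum-HypersonicLadder"]
def HypersonicAdiabat : Prop :=
  ∃ η₀ : ℝ, 0 < η₀ ∧ ∀ β : ℝ, 0 < β → β < 1 / 3 → ∀ (a₀ θ₀ : Literature.MathematicalPhysics.KineticTheory.T3 → ℝ) (u₀ : Literature.MathematicalPhysics.KineticTheory.T3 → Literature.MathematicalPhysics.KineticTheory.V3), Continuous a₀ → Continuous θ₀ → Continuous u₀ → (∀ x, 0 < a₀ x) → (∀ x, 0 < θ₀ x) → ∃ σ₀ : ℝ, 0 < σ₀ ∧ ∀ σ : ℝ, 0 < σ → σ < σ₀ → ∀ (T : ℝ) (ρ : ℝ → Literature.MathematicalPhysics.KineticTheory.T3 → ℝ) (u : ℝ → Literature.MathematicalPhysics.KineticTheory.T3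 → Literature.MathematicalPhysics.KineticTheory.V3), Literature.Analysis.FunctionSpaces.Torus.IsSmoothSpaceTimeOn (Set.Ico 0 T) ρ → Literature.Analysis.FunctionSpaces.Torus.IsSmoothSpaceTimeOn (Set.Ico 0 T) u → (∀ t ∈ Set.Ico 0 T, ∀ x, 0 < ρ t x) → (∀ t ∈ Set.Ico 0 T, ∀ x, ρ t x * σ ^ 3 < η₀) → (∀ t ∈ Set.Ico 0 T, ∀ x, Literature.Analysis.FunctionSpaces.Torus.timeDerivWithin (Set.Ico 0 T) ρ t x + Literature.Analysis.FunctionSpaces.Torus.divergence (fun y => ρ t y • u t y) x = 0) → (∀ t ∈ Set.Ico 0 T, ∀ x, Literature.Analysis.FunctionSpaces.Torus.timeDerivWithin (Set.Ico 0 T) u t x + Literature.Analysis.FunctionSpaces.Torus.convect (u t) (u t) x = 0) → ∀ (θ : ℝ → Literature.MathematicalPhysics.KineticTheory.T3 → ℝ), Literature.Analysis.FunctionSpaces.Torus.IsSmoothSpaceTimeOn (Set.Ico 0 T) θ → (∀ t ∈ Set.Ico 0 T, ∀ x, 0 < θ t x) → (∀ x, θ 0 x = θ₀ x) → (∀ t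 ∈ Set.Ico 0 T, ∀ x, Literature.Analysis.FunctionSpaces.Torus.timeDerivWithin (Set.Ico 0 T) θ t x + Literature.Analysis.FunctionSpaces.Torus.convect (u t) (θ t) x + 2 / 3 * θ t x * Literature.MathematicalPhysics.KineticTheory.hsCompressibility (ρ t x * σ ^ 3) * Literature.Analysis.FunctionSpaces.Torus.divergence (u t) x = 0) → ∀ Φ : (N : ℕ) → Literature.Analysis.FluidPDE.HardSphereFlow (Literature.Analysis.FluidPDE.Torus.geometry (Fin 3)) (Literature.MathematicalPhysics.KineticTheory.hsDiameter σ N) (N + 1), Literature.MathematicalPhysics.KineticTheory.TendstoHydroFieldsAt (fun N => Literature.MathematicalPhysics.KineticTheory.localGibbsLaw σ a₀ u₀ (fun x => ((N + 1 : ℕ) : ℝ) ^ (-(2 * β)) * θ₀ x) N (Φ N)) Φ ρ u (fun _ _ => (0 : ℝ)) 0 → (∀ χ : Literature.MathematicalPhysics.KineticTheory.T3 → ℝ, Continuous χ → ∀ δ > (0 : ℝ), Filter.Tendsto (fun N : ℕ => (Literature.MathematicalPhysics.KineticTheory.localGibbsLaw σ a₀ u₀ (fun x => ((N + 1 : ℕ)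 : ℝ) ^ (-(2 * β)) * θ₀ x) N (Φ N)) {z | δ < |((N + 1 : ℕ) : ℝ) ^ (2 * β) * (∫ y, χ y.1 * (‖y.2 - u 0 y.1‖ ^ 2 / 2) ∂Literature.Analysis.FluidPDE.empiricalMeasure ((Φ N).flow 0 z)) - ∫ x, χ x * (3 / 2 * ρ 0 x * θ₀ x)|}) Filter.atTop (nhds 0)) → ∀ t ∈ Set.Ico 0 T, Literature.MathematicalPhysics.KineticTheory.TendstoHydroFieldsAt (fun N => Literature.MathematicalPhysics.KineticTheory.localGibbsLaw σ a₀ u₀ (fun x => ((N + 1 : ℕ) : ℝ) ^ (-(2 * β)) * θ₀ x) N (Φ N)) Φ ρ u (fun _ _ => (0 : ℝ)) t ∧ (∀ χ : Literature.MathematicalPhysics.KineticTheory.T3 → ℝ, Continuous χ → ∀ δ > (0 : ℝ), Filter.Tendsto (fun N : ℕ => (Literature.MathematicalPhysics.KineticTheory.localGibbsLaw σ a₀ u₀ (fun x => ((N + 1 : ℕ) : ℝ) ^ (-(2 * β)) * θ₀ x) N (Φ N)) {z | δ < |((N + 1 : ℕ) : ℝ) ^ (2 * β) * (∫ y, χ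 y.1 * (‖y.2 - u t y.1‖ ^ 2 / 2) ∂Literature.Analysis.FluidPDE.empiricalMeasure ((Φ N).flow t z)) - ∫ x, χ x * (3 / 2 * ρ t x * θ t x)|}) Filter.atTop (nhds 0))

/-- item stmt-AtomisticToContinuum-6342 · crux · rank 2 · closed · moot by None · by planner
why it might fail: it IS the closure for deterministic spheres (BoltzmannHypothesis barrier in substance) at depth N^(1/3−β) with rings present at O(σ³); a proof must exhibit dilution of shared collision ancestry at FIXED packing; false at β = 1/3 (JNV self-similar anisotropic states).
sources: Spohn1991, OllaVaradhanYau1993, doi:10.1007/s00332-019-09535-6, doi:10.1007/s00205-018-1289-2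
[crux] KINETIC ISOTROPISATION AT DEPTH N^(1/3−β) (card crux 1, kinetic half): same data/driver/guard
as the Target (no θ̂ needed); for every t < T and every jointly continuous field of test operators
B(s,x) ∈ L(ℝ³): (N+1)^(2β)·∫₀ᵗ N⁻¹Σᵢ[⟨wᵢ, B(s,xᵢ)wᵢ⟩ − |wᵢ|² tr B(s,xᵢ)/3] ds → 0 in probability, wᵢ
= vᵢ − ū(s,xᵢ(s)) — the time-integrated rescaled TRACELESS kinetic peculiar stress vanishes.
[difficulty: open-problem] -/
@[route_item "route-AtomisticToContinuum-HypersonicLadder"]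
def KineticIsotropisation : Prop :=
  ∃ η₀ : ℝ, 0 < η₀ ∧ ∀ β : ℝ, 0 < β → β < 1 / 3 → ∀ (a₀ θ₀ : Literature.MathematicalPhysics.KineticTheory.T3 → ℝ) (u₀ : Literature.MathematicalPhysics.KineticTheory.T3 → Literature.MathematicalPhysics.KineticTheory.V3), Continuous a₀ → Continuous θ₀ → Continuous u₀ → (∀ x, 0 < a₀ x) → (∀ x, 0 < θ₀ x) → ∃ σ₀ : ℝ, 0 < σ₀ ∧ ∀ σ : ℝ, 0 < σ → σ < σ₀ → ∀ (T : ℝ) (ρ : ℝ → Literature.MathematicalPhysics.KineticTheory.T3 → ℝ) (u : ℝ → Literature.MathematicalPhysics.KineticTheory.T3 → Literature.MathematicalPhysics.KineticTheory.V3), Literature.Analysis.FunctionSpaces.Torus.IsSmoothSpaceTimeOn (Set.Ico 0 T) ρ → Literature.Analysis.FunctionSpaces.Torus.IsSmoothSpaceTimeOn (Set.Ico 0 T) u → (∀ t ∈ Set.Ico 0 T, ∀ x, 0 < ρ t x) → (∀ t ∈ Set.Ico 0 T, ∀ x, ρ t x * σ ^ 3 < η₀) → (∀ t ∈ Set.Ico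 0 T, ∀ x, Literature.Analysis.FunctionSpaces.Torus.timeDerivWithin (Set.Ico 0 T) ρ t x + Literature.Analysis.FunctionSpaces.Torus.divergence (fun y => ρ t y • u t y) x = 0) → (∀ t ∈ Set.Ico 0 T, ∀ x, Literature.Analysis.FunctionSpaces.Torus.timeDerivWithin (Set.Ico 0 T) u t x + Literature.Analysis.FunctionSpaces.Torus.convect (u t) (u t) x = 0) → ∀ Φ : (N : ℕ) → Literature.Analysis.FluidPDE.HardSphereFlow (Literature.Analysis.FluidPDE.Torus.geometry (Fin 3)) (Literature.MathematicalPhysics.KineticTheory.hsDiameter σ N) (N + 1), Literature.MathematicalPhysics.KineticTheory.TendstoHydroFieldsAt (fun N => Literature.MathematicalPhysics.KineticTheory.localGibbsLaw σ a₀ u₀ (fun x => ((N + 1 : ℕ) : ℝ) ^ (-(2 * β)) * θ₀ x) N (Φ N)) Φ ρ u (fun _ _ => (0 : ℝ)) 0 → (∀ χ : Literature.MathematicalPhysics.KineticTheory.T3 → ℝ, Continuous χ → ∀ δ > (0 : ℝ), Filter.Tendsto (fun N : ℕ => (Literature.MathematicalPhysics.KineticTheory.localGibbsLaw σ a₀ u₀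 (fun x => ((N + 1 : ℕ) : ℝ) ^ (-(2 * β)) * θ₀ x) N (Φ N)) {z | δ < |((N + 1 : ℕ) : ℝ) ^ (2 * β) * (∫ y, χ y.1 * (‖y.2 - u 0 y.1‖ ^ 2 / 2) ∂Literature.Analysis.FluidPDE.empiricalMeasure ((Φ N).flow 0 z)) - ∫ x, χ x * (3 / 2 * ρ 0 x * θ₀ x)|}) Filter.atTop (nhds 0)) → ∀ t ∈ Set.Ico 0 T, ∀ B : ℝ → Literature.MathematicalPhysics.KineticTheory.T3 → (Literature.MathematicalPhysics.KineticTheory.V3 →L[ℝ] Literature.MathematicalPhysics.KineticTheory.V3), Continuous (Function.uncurry B) → ∀ δ > (0 : ℝ), Filter.Tendsto (fun N : ℕ => (Literature.MathematicalPhysics.KineticTheory.localGibbsLaw σ a₀ u₀ (fun x => ((N + 1 : ℕ) : ℝ) ^ (-(2 * β)) * θ₀ x) N (Φ N)) {z | δ < |((N + 1 : ℕ) : ℝ) ^ (2 * β) * ∫ s in (0 : ℝ)..t, ∫ y, (inner ℝ (y.2 - u s y.1) (B s y.1 (y.2 - u s y.1)) - ‖y.2 - u s y.1‖ ^ 2 /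 3 * LinearMap.trace ℝ Literature.MathematicalPhysics.KineticTheory.V3 (B s y.1).toLinearMap) ∂Literature.Analysis.FluidPDE.empiricalMeasure ((Φ N).flow s z)|}) Filter.atTop (nhds 0)

/-- item stmt-AtomisticToContinuum-6343 · crux · rank 3 · closed · moot by None · by planner
why it might fail: the pair correlation AT CONTACT along the evolved cold law must take its local-equilibrium value (↔ Z−1) with isotropic contact normals; cold caged clusters / force chains transmit collisional stress at vanishing kinetic energy (rattler problem (R): positive packing bites here first).
sources: Spohn1991, Ruelle1969, PulvirentiSimonella2016, GallagherSaintRaymondTexier2013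
[crux] COLLISIONAL HEATING LAW = the (Z−1) part of p dV work (card: 'adiabats carrying Z';
contact-value statistics along the evolved cold law), typed WITHOUT a collision API through the
exact pathwise balance of the modulated energy: for t < T and every space-time test function χ
smooth on [0,t]×𝕋³, (N+1)^(2β)·[K_N(t,χ_t) − K_N(0,χ_0) − ∫₀ᵗ(transport (∂ₛχ + v·∇χ)|w|²/2 − kinetic
stress work χ⟨w,(w·∇)ū⟩) ds + ∫₀ᵗ N⁻¹Σᵢχ(s,xᵢ)(Z(ρ̄(s,xᵢ)σ³) − 1)|wᵢ|² div ū(s,xᵢ)/3 ds] → 0 in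
probability, K_N(t,χ_t) = N⁻¹Σᵢχ(t,xᵢ)|vᵢ − ū(t,xᵢ)|²/2; the bracket equals pathwise (collisional
work on the thermal cloud) + ∫(Z−1)·(isotropic kinetic compression heating), so the law says:
collisional heating = (Z−1) × kinetic compression heating, locally in space-time. [difficulty: XL] -/
@[route_item "route-AtomisticToContinuum-HypersonicLadder"]
def CollisionalHeatingLaw : Prop :=
  ∃ η₀ : ℝ, 0 < η₀ ∧ ∀ β : ℝ, 0 < β → β < 1 / 3 → ∀ (a₀ θ₀ : Literature.MathematicalPhysics.KineticTheory.T3 → ℝ) (u₀ : Literature.MathematicalPhysics.KineticTheory.T3 → Literature.MathematicalPhysics.KineticTheory.V3), Continuous a₀ → Continuous θ₀ → Continuous u₀ → (∀ x, 0 < a₀ x) → (∀ x, 0 < θ₀ x) → ∃ σ₀ : ℝ, 0 < σ₀ ∧ ∀ σ : ℝ, 0 < σ → σ < σ₀ → ∀ (T : ℝ) (ρ : ℝ → Literature.MathematicalPhysics.KineticTheory.T3 → ℝ) (u : ℝ → Literature.MathematicalPhysics.KineticTheory.T3 → Literature.MathematicalPhysics.KineticTheory.V3), Literature.Analysis.FunctionSpaces.Torus.IsSmoothSpaceTimeOn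 (Set.Ico 0 T) ρ → Literature.Analysis.FunctionSpaces.Torus.IsSmoothSpaceTimeOn (Set.Ico 0 T) u → (∀ t ∈ Set.Ico 0 T, ∀ x, 0 < ρ t x) → (∀ t ∈ Set.Ico 0 T, ∀ x, ρ t x * σ ^ 3 < η₀) → (∀ t ∈ Set.Ico 0 T, ∀ x, Literature.Analysis.FunctionSpaces.Torus.timeDerivWithin (Set.Ico 0 T) ρ t x + Literature.Analysis.FunctionSpaces.Torus.divergence (fun y => ρ t y • u t y) x = 0) → (∀ t ∈ Set.Ico 0 T, ∀ x, Literature.Analysis.FunctionSpaces.Torus.timeDerivWithin (Set.Ico 0 T) u t x + Literature.Analysis.FunctionSpaces.Torus.convect (u t) (u t) x = 0) → ∀ Φ : (N : ℕ) → Literature.Analysis.FluidPDE.HardSphereFlow (Literature.Analysis.FluidPDE.Torus.geometry (Fin 3)) (Literature.MathematicalPhysics.KineticTheory.hsDiameter σ N) (N + 1), Literature.MathematicalPhysics.KineticTheory.TendstoHydroFieldsAt (fun N => Literature.MathematicalPhysics.KineticTheory.localGibbsLaw σ a₀ u₀ (fun x => ((N + 1 : ℕ) : ℝ) ^ (-(2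 * β)) * θ₀ x) N (Φ N)) Φ ρ u (fun _ _ => (0 : ℝ)) 0 → (∀ χ : Literature.MathematicalPhysics.KineticTheory.T3 → ℝ, Continuous χ → ∀ δ > (0 : ℝ), Filter.Tendsto (fun N : ℕ => (Literature.MathematicalPhysics.KineticTheory.localGibbsLaw σ a₀ u₀ (fun x => ((N + 1 : ℕ) : ℝ) ^ (-(2 * β)) * θ₀ x) N (Φ N)) {z | δ < |((N + 1 : ℕ) : ℝ) ^ (2 * β) * (∫ y, χ y.1 * (‖y.2 - u 0 y.1‖ ^ 2 / 2) ∂Literature.Analysis.FluidPDE.empiricalMeasure ((Φ N).flow 0 z)) - ∫ x, χ x * (3 / 2 * ρ 0 x * θ₀ x)|}) Filter.atTop (nhds 0)) → ∀ t ∈ Set.Ico 0 T, ∀ χ : ℝ → Literature.MathematicalPhysics.KineticTheory.T3 → ℝ, Literature.Analysis.FunctionSpaces.Torus.IsSmoothSpaceTimeOn (Set.Icc 0 t) χ → ∀ δ > (0 : ℝ), Filter.Tendsto (fun N : ℕ => (Literature.MathematicalPhysics.KineticTheory.localGibbsLaw σ a₀ u₀ (fun x => ((N + 1 : ℕ) :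 ℝ) ^ (-(2 * β)) * θ₀ x) N (Φ N)) {z | δ < |((N + 1 : ℕ) : ℝ) ^ (2 * β) * (((∫ y, χ t y.1 * (‖y.2 - u t y.1‖ ^ 2 / 2) ∂Literature.Analysis.FluidPDE.empiricalMeasure ((Φ N).flow t z)) - (∫ y, χ 0 y.1 * (‖y.2 - u 0 y.1‖ ^ 2 / 2) ∂Literature.Analysis.FluidPDE.empiricalMeasure ((Φ N).flow 0 z)) - (∫ s in (0 : ℝ)..t, ((∫ y, (Literature.Analysis.FunctionSpaces.Torus.timeDerivWithin (Set.Icc 0 t) χ s y.1 + Literature.Analysis.FunctionSpaces.Torus.fderiv (χ s) y.1 y.2) * (‖y.2 - u s y.1‖ ^ 2 / 2) ∂Literature.Analysis.FluidPDE.empiricalMeasure ((Φ N).flow s z)) - (∫ y, χ s y.1 * inner ℝ (y.2 - u s y.1) (Literature.Analysis.FunctionSpaces.Torus.fderiv (u s) y.1 (y.2 - u s y.1)) ∂Literature.Analysis.FluidPDE.empiricalMeasure ((Φ N).flow s z))))) + (∫ s in (0 : ℝ)..t, ∫ y, χ s y.1 * ((Literature.MathematicalPhysics.KineticTheory.hsCompressibility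 (ρ s y.1 * σ ^ 3) - 1) * (‖y.2 - u s y.1‖ ^ 2 / 3) * Literature.Analysis.FunctionSpaces.Torus.divergence (u s) y.1) ∂Literature.Analysis.FluidPDE.empiricalMeasure ((Φ N).flow s z)))|}) Filter.atTop (nhds 0)

/-- item stmt-AtomisticToContinuum-6344 · crux · rank 4 · closed · moot by None · by planner
why it might fail: no anomalous heating and no fat peculiar tails along the deterministic evolution: pathwise Povzner-type control of collision cascades at positive packing is open (apriori-tails-and-rattlers (T),(R)); a Gronwall for the quadratic moment needs a mean collisional-pressure bound, the cubic one more.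
sources: Spohn1991, HanKwanIacobelli2021, KipnisLandim1999
[crux] COLD TAILS-AND-RATTLERS INPUT (card crux 3, cubic form required by the glue's transport
term): same setting; for every t < T the rescaled cubic peculiar moments (N+1)^(3β)·N⁻¹Σᵢ|vᵢ −
ū(t,xᵢ)|³ and their time integrals over [0,t] are tight (bounded in probability uniformly in N).
[difficulty: L] -/
@[route_item "route-AtomisticToContinuum-HypersonicLadder"]
def ThermalTightness : Prop :=
  ∃ η₀ : ℝ, 0 < η₀ ∧ ∀ β : ℝ, 0 < β → β < 1 / 3 → ∀ (a₀ θ₀ : Literature.MathematicalPhysics.KineticTheory.T3 → ℝ) (u₀ : Literature.MathematicalPhysics.KineticTheory.T3 → Literature.MathematicalPhysics.KineticTheory.V3), Continuous a₀ → Continuous θ₀ → Continuous u₀ → (∀ x, 0 < a₀ x) → (∀ x, 0 < θ₀ x) → ∃ σ₀ : ℝ, 0 < σ₀ ∧ ∀ σ : ℝ, 0 < σ → σ < σ₀ → ∀ (T : ℝ) (ρ : ℝ → Literature.MathematicalPhysics.KineticTheory.T3 → ℝ) (u : ℝ → Literature.MathematicalPhysics.KineticTheory.T3 → Literature.MathematicalPhysics.KineticTheory.V3),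 Literature.Analysis.FunctionSpaces.Torus.IsSmoothSpaceTimeOn (Set.Ico 0 T) ρ → Literature.Analysis.FunctionSpaces.Torus.IsSmoothSpaceTimeOn (Set.Ico 0 T) u → (∀ t ∈ Set.Ico 0 T, ∀ x, 0 < ρ t x) → (∀ t ∈ Set.Ico 0 T, ∀ x, ρ t x * σ ^ 3 < η₀) → (∀ t ∈ Set.Ico 0 T, ∀ x, Literature.Analysis.FunctionSpaces.Torus.timeDerivWithin (Set.Ico 0 T) ρ t x + Literature.Analysis.FunctionSpaces.Torus.divergence (fun y => ρ t y • u t y) x = 0) → (∀ t ∈ Set.Ico 0 T, ∀ x, Literature.Analysis.FunctionSpaces.Torus.timeDerivWithin (Set.Ico 0 T) u t x + Literature.Analysis.FunctionSpaces.Torus.convect (u t) (u t) x = 0) → ∀ Φ : (N : ℕ) → Literature.Analysis.FluidPDE.HardSphereFlow (Literature.Analysis.FluidPDE.Torus.geometry (Fin 3)) (Literature.MathematicalPhysics.KineticTheory.hsDiameter σ N) (N + 1), Literature.MathematicalPhysics.KineticTheory.TendstoHydroFieldsAt (fun N => Literature.MathematicalPhysics.KineticTheory.localGibbsLaw σ a₀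 u₀ (fun x => ((N + 1 : ℕ) : ℝ) ^ (-(2 * β)) * θ₀ x) N (Φ N)) Φ ρ u (fun _ _ => (0 : ℝ)) 0 → (∀ χ : Literature.MathematicalPhysics.KineticTheory.T3 → ℝ, Continuous χ → ∀ δ > (0 : ℝ), Filter.Tendsto (fun N : ℕ => (Literature.MathematicalPhysics.KineticTheory.localGibbsLaw σ a₀ u₀ (fun x => ((N + 1 : ℕ) : ℝ) ^ (-(2 * β)) * θ₀ x) N (Φ N)) {z | δ < |((N + 1 : ℕ) : ℝ) ^ (2 * β) * (∫ y, χ y.1 * (‖y.2 - u 0 y.1‖ ^ 2 / 2) ∂Literature.Analysis.FluidPDE.empiricalMeasure ((Φ N).flow 0 z)) - ∫ x, χ x * (3 / 2 * ρ 0 x * θ₀ x)|}) Filter.atTop (nhds 0)) → ∀ t ∈ Set.Ico 0 T, ∀ ε > (0 : ℝ), ∃ C : ℝ, ∀ᶠ N : ℕ in Filter.atTop, (Literature.MathematicalPhysics.KineticTheory.localGibbsLaw σ a₀ u₀ (fun x => ((N + 1 : ℕ) : ℝ) ^ (-(2 * β)) * θ₀ x) N (Φ N)) {z | C < ((N + 1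 : ℕ) : ℝ) ^ (3 * β) * ∫ y, ‖y.2 - u t y.1‖ ^ 3 ∂Literature.Analysis.FluidPDE.empiricalMeasure ((Φ N).flow t z)} ≤ ENNReal.ofReal ε ∧ (Literature.MathematicalPhysics.KineticTheory.localGibbsLaw σ a₀ u₀ (fun x => ((N + 1 : ℕ) : ℝ) ^ (-(2 * β)) * θ₀ x) N (Φ N)) {z | C < ((N + 1 : ℕ) : ℝ) ^ (3 * β) * ∫ s in (0 : ℝ)..t, ∫ y, ‖y.2 - u s y.1‖ ^ 3 ∂Literature.Analysis.FluidPDE.empiricalMeasure ((Φ N).flow s z)} ≤ ENNReal.ofReal ε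

/-- item stmt-AtomisticToContinuum-6345 · crux · rank 5 · closed · moot by None · by planner
why it might fail: a deterministic limit at all t < T needs finite-depth propagation of chaos at FIXED packing along a deforming frame — classical in spirit only for c(σ)t below a Lanford radius (finite recollision classes must be kept, bookkeeping never written at positive packing); beyond it nothing is known.
sources: Lanford1975, King1975, GallagherSaintRaymondTexier2013, PulvirentiSimonella2016, doi:10.1007/s00205-018-1289-2, arXiv:2506.15449
[crux] CRITICAL RUNG β = 1/3 (card crux 2, law-of-large-numbers form): a LANFORD REGIME AT FIXED
PACKING hidden in Hilbert's scaling — O(1) collisions per particle per macroscopic time (Nε²wt =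
O(1) for the peculiar motion although Nε³ = σ³ is fixed) in the slowly deforming affine frame ∇ū:
there is a continuous positive field θc(t,x) (a local functional Θ_σ of the deformation history,
non-Maxwellian peculiar law — the N-body counterpart of homoenergetic flows) such that, under the
same t = 0 hypotheses, the fields follow pressureless Euler and the rescaled thermal field converges
in probability to (3/2)ρ̄θc(t) for all t < T. [difficulty: open-problem] -/
@[route_item "route-AtomisticToContinuum-HypersonicLadder"]
def CriticalRungLLN : Prop :=
  ∃ η₀ : ℝ, 0 < η₀ ∧ ∀ β : ℝ, β = 1 / 3 → ∀ (a₀ θ₀ : Literature.MathematicalPhysics.KineticTheory.T3 → ℝ) (u₀ : Literature.MathematicalPhysics.KineticTheory.T3 → Literature.MathematicalPhysics.KineticTheory.V3), Continuous a₀ → Continuous θ₀ → Continuous u₀ → (∀ x, 0 < a₀ x) → (∀ x, 0 < θ₀ x) → ∃ σ₀ : ℝ, 0 < σ₀ ∧ ∀ σ : ℝ, 0 < σ → σ < σ₀ → ∀ (T : ℝ) (ρ : ℝ → Literature.MathematicalPhysics.KineticTheory.T3 → ℝ) (u : ℝ → Literature.MathematicalPhysics.KineticTheory.T3 → Literature.MathematicalPhysics.KineticTheory.V3),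 Literature.Analysis.FunctionSpaces.Torus.IsSmoothSpaceTimeOn (Set.Ico 0 T) ρ → Literature.Analysis.FunctionSpaces.Torus.IsSmoothSpaceTimeOn (Set.Ico 0 T) u → (∀ t ∈ Set.Ico 0 T, ∀ x, 0 < ρ t x) → (∀ t ∈ Set.Ico 0 T, ∀ x, ρ t x * σ ^ 3 < η₀) → (∀ t ∈ Set.Ico 0 T, ∀ x, Literature.Analysis.FunctionSpaces.Torus.timeDerivWithin (Set.Ico 0 T) ρ t x + Literature.Analysis.FunctionSpaces.Torus.divergence (fun y => ρ t y • u t y) x = 0) → (∀ t ∈ Set.Ico 0 T, ∀ x, Literature.Analysis.FunctionSpaces.Torus.timeDerivWithin (Set.Ico 0 T) u t x + Literature.Analysis.FunctionSpaces.Torus.convect (u t) (u t) x = 0) → ∃ θc : ℝ → Literature.MathematicalPhysics.KineticTheory.T3 → ℝ, ContinuousOn (Function.uncurry θc) (Set.Ico 0 T ×ˢ Set.univ) ∧ (∀ t ∈ Set.Ico 0 T, ∀ x, 0 < θc t x) ∧ ∀ Φ : (N : ℕ) → Literature.Analysis.FluidPDE.HardSphereFlow (Literature.Analysis.FluidPDE.Torus.geometry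 (Fin 3)) (Literature.MathematicalPhysics.KineticTheory.hsDiameter σ N) (N + 1), Literature.MathematicalPhysics.KineticTheory.TendstoHydroFieldsAt (fun N => Literature.MathematicalPhysics.KineticTheory.localGibbsLaw σ a₀ u₀ (fun x => ((N + 1 : ℕ) : ℝ) ^ (-(2 * β)) * θ₀ x) N (Φ N)) Φ ρ u (fun _ _ => (0 : ℝ)) 0 → (∀ χ : Literature.MathematicalPhysics.KineticTheory.T3 → ℝ, Continuous χ → ∀ δ > (0 : ℝ), Filter.Tendsto (fun N : ℕ => (Literature.MathematicalPhysics.KineticTheory.localGibbsLaw σ a₀ u₀ (fun x => ((N + 1 : ℕ) : ℝ) ^ (-(2 * β)) * θ₀ x) N (Φ N)) {z | δ < |((N + 1 : ℕ) : ℝ) ^ (2 * β) * (∫ y, χ y.1 * (‖y.2 - u 0 y.1‖ ^ 2 / 2) ∂Literature.Analysis.FluidPDE.empiricalMeasure ((Φ N).flow 0 z)) - ∫ x, χ x * (3 / 2 * ρ 0 x * θ₀ x)|}) Filter.atTop (nhds 0)) → ∀ t ∈ Set.Ico 0 T, Literature.MathematicalPhysics.KineticTheory.TendstoHydroFieldsAt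 (fun N => Literature.MathematicalPhysics.KineticTheory.localGibbsLaw σ a₀ u₀ (fun x => ((N + 1 : ℕ) : ℝ) ^ (-(2 * β)) * θ₀ x) N (Φ N)) Φ ρ u (fun _ _ => (0 : ℝ)) t ∧ (∀ χ : Literature.MathematicalPhysics.KineticTheory.T3 → ℝ, Continuous χ → ∀ δ > (0 : ℝ), Filter.Tendsto (fun N : ℕ => (Literature.MathematicalPhysics.KineticTheory.localGibbsLaw σ a₀ u₀ (fun x => ((N + 1 : ℕ) : ℝ) ^ (-(2 * β)) * θ₀ x) N (Φ N)) {z | δ < |((N + 1 : ℕ) : ℝ) ^ (2 * β) * (∫ y, χ y.1 * (‖y.2 - u t y.1‖ ^ 2 / 2) ∂Literature.Analysis.FluidPDE.empiricalMeasure ((Φ N).flow t z)) - ∫ x, χ x * (3 / 2 * ρ t x * θc t x)|}) Filter.atTop (nhds 0))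

/-- item stmt-AtomisticToContinuum-6346 · support · rank 9 · closed · moot by None · by planner
sources: Spohn1991, doi:10.1088/1361-6544/ab853f, Ruelle1969, Sznitman1991
[support] COLLISION-SPARSE TOP RUNG β > 1/3 (card S1): a typical particle never collides before the
caustic (collision graph ⊂ a static random geometric graph of degree O(t N^(1/3−β) √log N)); the
fields follow pressureless Euler and the rescaled peculiar COVARIANCE field
(N+1)^(2β)·N⁻¹Σᵢχ(xᵢ)⟨wᵢ,e₁⟩⟨wᵢ,e₂⟩ converges to ∫χρ̄⟨e₁,Σe₂⟩ where the smooth operator field Σ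
codeforms: ∂ₜΣ + (ū·∇)Σ + AΣ + ΣAᵀ = 0, A = ∇ū (Lagrangian form Σ = F⁻¹Θ₀F⁻ᵀ, F = I + t∇ū₀) —
anisotropic, no equation of state, teeth of the ladder (the ideal gas passes this rung and fails
every adiabatic one). Proof plan: Gaussian max of peculiar speeds, deterministic TUBE LEMMA (true
collisions ⊂ pairs whose free-flight paths come within ε + 2w*t), degree bound of the static graph
under the canonical hard-sphere law at small packing, ELASTIC CONVEXITY bootstrap after ≤ K
collisions, static free-flight LLN. [difficulty: L] -/
@[route_item "route-AtomisticToContinuum-HypersonicLadder"]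
def HypersonicSparse : Prop :=
  ∃ η₀ : ℝ, 0 < η₀ ∧ ∀ β : ℝ, 1 / 3 < β → ∀ (a₀ θ₀ : Literature.MathematicalPhysics.KineticTheory.T3 → ℝ) (u₀ : Literature.MathematicalPhysics.KineticTheory.T3 → Literature.MathematicalPhysics.KineticTheory.V3), Continuous a₀ → Continuous θ₀ → Continuous u₀ → (∀ x, 0 < a₀ x) → (∀ x, 0 < θ₀ x) → ∃ σ₀ : ℝ, 0 < σ₀ ∧ ∀ σ : ℝ, 0 < σ → σ < σ₀ → ∀ (T : ℝ) (ρ : ℝ → Literature.MathematicalPhysics.KineticTheory.T3 → ℝ) (u : ℝ → Literature.MathematicalPhysics.KineticTheory.T3 → Literature.MathematicalPhysics.KineticTheory.V3), Literature.Analysis.FunctionSpaces.Torus.IsSmoothSpaceTimeOn (Set.Ico 0 T) ρ → Literature.Analysis.FunctionSpaces.Torus.IsSmoothSpaceTimeOn (Set.Ico 0 T) u → (∀ t ∈ Set.Ico 0 T, ∀ x, 0 < ρ t x) → (∀ t ∈ Set.Ico 0 T, ∀ x, ρ t x * σ ^ 3 < η₀) → (∀ t ∈ Set.Ico 0 T,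 ∀ x, Literature.Analysis.FunctionSpaces.Torus.timeDerivWithin (Set.Ico 0 T) ρ t x + Literature.Analysis.FunctionSpaces.Torus.divergence (fun y => ρ t y • u t y) x = 0) → (∀ t ∈ Set.Ico 0 T, ∀ x, Literature.Analysis.FunctionSpaces.Torus.timeDerivWithin (Set.Ico 0 T) u t x + Literature.Analysis.FunctionSpaces.Torus.convect (u t) (u t) x = 0) → ∀ (S : ℝ → Literature.MathematicalPhysics.KineticTheory.T3 → (Literature.MathematicalPhysics.KineticTheory.V3 →L[ℝ] Literature.MathematicalPhysics.KineticTheory.V3)), Literature.Analysis.FunctionSpaces.Torus.IsSmoothSpaceTimeOn (Set.Ico 0 T) S → (∀ t ∈ Set.Ico 0 T, ∀ x, Literature.Analysis.FunctionSpaces.Torus.timeDerivWithin (Set.Ico 0 T) S t x + Literature.Analysis.FunctionSpaces.Torus.convect (u t) (S t) x + (Literature.Analysis.FunctionSpaces.Torus.fderiv (u t) x).comp (S t x) + (S t x).comp (ContinuousLinearMap.adjoint (Literature.Analysis.FunctionSpaces.Torus.fderiv (u t) x)) = 0) → ∀ Φ : (N : ℕ) → Literature.Analysis.FluidPDE.HardSphereFlow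 (Literature.Analysis.FluidPDE.Torus.geometry (Fin 3)) (Literature.MathematicalPhysics.KineticTheory.hsDiameter σ N) (N + 1), Literature.MathematicalPhysics.KineticTheory.TendstoHydroFieldsAt (fun N => Literature.MathematicalPhysics.KineticTheory.localGibbsLaw σ a₀ u₀ (fun x => ((N + 1 : ℕ) : ℝ) ^ (-(2 * β)) * θ₀ x) N (Φ N)) Φ ρ u (fun _ _ => (0 : ℝ)) 0 → (∀ χ : Literature.MathematicalPhysics.KineticTheory.T3 → ℝ, Continuous χ → ∀ (e₁ e₂ : Literature.MathematicalPhysics.KineticTheory.V3), ∀ δ > (0 : ℝ), Filter.Tendsto (fun N : ℕ => (Literature.MathematicalPhysics.KineticTheory.localGibbsLaw σ a₀ u₀ (fun x => ((N + 1 : ℕ) : ℝ) ^ (-(2 * β)) * θ₀ x) N (Φ N)) {z | δ < |((N + 1 : ℕ) : ℝ) ^ (2 * β) * (∫ y, χ y.1 * (inner ℝ (y.2 - u 0 y.1) e₁ * inner ℝ (y.2 - u 0 y.1) e₂) ∂Literature.Analysis.FluidPDE.empiricalMeasure ((Φ N).flow 0 z)) - ∫ x, χ x * (ρ 0 x * inner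 ℝ e₁ (S 0 x e₂))|}) Filter.atTop (nhds 0)) → ∀ t ∈ Set.Ico 0 T, Literature.MathematicalPhysics.KineticTheory.TendstoHydroFieldsAt (fun N => Literature.MathematicalPhysics.KineticTheory.localGibbsLaw σ a₀ u₀ (fun x => ((N + 1 : ℕ) : ℝ) ^ (-(2 * β)) * θ₀ x) N (Φ N)) Φ ρ u (fun _ _ => (0 : ℝ)) t ∧ (∀ χ : Literature.MathematicalPhysics.KineticTheory.T3 → ℝ, Continuous χ → ∀ (e₁ e₂ : Literature.MathematicalPhysics.KineticTheory.V3), ∀ δ > (0 : ℝ), Filter.Tendsto (fun N : ℕ => (Literature.MathematicalPhysics.KineticTheory.localGibbsLaw σ a₀ u₀ (fun x => ((N + 1 : ℕ) : ℝ) ^ (-(2 * β)) * θ₀ x) N (Φ N)) {z | δ < |((N + 1 : ℕ) : ℝ) ^ (2 * β) * (∫ y, χ y.1 * (inner ℝ (y.2 - u t y.1) e₁ * inner ℝ (y.2 - u t y.1) e₂) ∂Literature.Analysis.FluidPDE.empiricalMeasure ((Φ N).flow t z)) - ∫ x, χ x * (ρ t x * inner ℝ e₁ (S t x e₂))|}) Filter.atTop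 (nhds 0))

/-- item stmt-AtomisticToContinuum-6347 · support · rank 9 · closed · moot by None · by planner
sources: HanKwanIacobelli2021, Serfaty2020, doi:10.2140/apde.2019.12.843
[support] MODULATED-ENERGY GLUE: KineticIsotropisation → CollisionalHeatingLaw → ThermalTightness →
HypersonicAdiabat. Proof plan (soft, no collision API): (1) tightness ⇒ K_N(t,1) → 0 ⇒ velocities
concentrate on ū(t,x) (monokinetic mechanism of HanKwanIacobelli2021) ⇒ with the exact microscopic
mass balance the empirical density is asymptotically a measure solution of the continuity equation
with the smooth field ū, unique ⇒ density, momentum, energy fields → pressureless values; (2) the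
rescaled thermal measures e_N(s) = (N+1)^(2β)|w|²/2·(empirical measure) are tight; the pathwise
balance of K_N + crux 2 (stress work → (2/3)e div ū) + crux 3 (collisional work → (Z−1)(2/3)e div ū)
+ crux 4 (cubic transport remainder (N+1)^(2β)∫|w·∇χ||w|² = O(N^(-β)) → 0) show every limit point
solves weakly ∂ₛe + div(e ū) = −(2/3)Z(ρ̄σ³)(div ū) e with e(0) = (3/2)ρ̄₀θ₀; (3) uniqueness for
this linear transport equation with smooth coefficients ⇒ e = (3/2)ρ̄θ̂. Take η₀, σ₀ as minima over
the three cruxes. [difficulty: L] -/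
@[route_item "route-AtomisticToContinuum-HypersonicLadder"]
def AdiabatGlue : Prop :=
  KineticIsotropisation → CollisionalHeatingLaw → ThermalTightness → HypersonicAdiabat

/-- item stmt-AtomisticToContinuum-6348 · assembly · rank 1 · closed · moot by None · by planner
sources: Spohn1991, HanKwanIacobelli2021
[assembly] KineticIsotropisation → CollisionalHeatingLaw → ThermalTightness → AdiabatGlue →
HypersonicAdiabat. -/
@[route_item "route-AtomisticToContinuum-HypersonicLadder"]
def Assembly : Prop :=
  KineticIsotropisation → CollisionalHeatingLaw → ThermalTightness → AdiabatGlue → HypersonicAdiabat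

end Summit.AtomisticToContinuum.HydrodynamicLimit.Theses.HypersonicLadder
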